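import Literature.Analysis.FluidPDE.ElgindiEllipticWeakExistence
import Literature.Analysis.FluidPDE.ElgindiPsiStar
import Mathlib.Analysis.Calculus.BumpFunction.Basic
import Mathlib.Analysis.Calculus.BumpFunction.InnerProduct
import HarnessLib

/-!
# The weak solution tests against all profiles: removing the orthogonality constraint
([Elgindi2021] §7.1, Proposition 7.1 and its Step 1)

Topic `Literature/Analysis/FluidPDE`. Support file (definitions with bodies and proved theorems, no
named facts) on the proof path of the named fact
`Literature.Analysis.FluidPDE.Elgindi.ElgindiGhoulMasmoudi2021_stabilityCore`
(`ElgindiStabilityDecomposition.lean`). T. M. Elgindi, Ann. of Math. 194 (2021) =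
arXiv:1904.04795, §7.1, proof of Proposition 7.1, Step 1 (p. 19 of the held text):

> "An important observation is that under the conditions of the lemma, `Ψ` must also be orthogonal
> to `sin(θ)cos²(θ)`. Indeed, define `Ψ⋆(R) := ∫₀^{π/2}Ψ(R,θ)sin(θ)cos²(θ)dθ`. Then, we see:
> `α²R²∂_{RR}Ψ⋆ + α(5+α)R∂_RΨ⋆ = 0`. This is because `sin(θ)cos²(θ)` is in the kernel of the adjoint
> problem when `α = 0`."

The weak solution of `ElgindiEllipticWeakExistence.lean` is obtained in the energy space of profiles
ORTHOGONAL to the adjoint mode `K = 3 sin θcos²θ`, so a priori it only tests against such profiles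
(a Lagrange multiplier `g(R)K(θ)` could appear). This file removes the constraint when the datum is
itself orthogonal to `K`: the same computation as Step 1 shows `(L(Ψ), K)_θ = 0` on every slice for
profiles `Ψ ⊥ K` (`kMoment_ellipticOp_eq_zero`), hence `B(U, Jχ_K) = 0` for the `K`-profile test
functions `χ_K = m(R)·sin θcos θ` and every `U` in the energy space (`energyForm_kProfile_eq_zero`);
decomposing an arbitrary test profile `χ₂ = χ₂^⊥ + χ_K` then gives the weak equation against all test
profiles (`weakSolution_test`).
-/

noncomputable section

open MeasureTheory Set Real Filter Function
open _root_.Topology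
open scoped ENNReal InnerProductSpace

namespace Literature.Analysis.FluidPDE

namespace Elgindi

/-! ### The `K`-moment of `L(Ψ)` -/

/-- **`(L(Ψ), K)_θ(R) = −α²R²(∂_{RR}Ψ, K)_θ − α(5+α)R(∂_RΨ, K)_θ`** for `Ψ ∈ C²` with
`Ψ(R,0) = Ψ(R,π/2) = 0`, `R > 0` (the angular part of `L` is killed by `K`: "`sin θcos²θ` is in the
kernel of the adjoint problem"). [cite: Elgindi2021, §7.1 proof of Proposition 7.1, Step 1 (p. 19 of arXiv:1904.04795)] -/
theorem kMoment_ellipticOp (α : ℝ) {Ψ : ℝ → ℝ → ℝ} (hΨ : ContDiff ℝ 2 (uncurry Ψ))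
    (hD0 : ∀ R, Ψ R 0 = 0) (hD1 : ∀ R, Ψ R (π / 2) = 0) {R : ℝ} (hR : 0 < R) :
    kMoment (ellipticOp α Ψ) R = -(α ^ 2 * R ^ 2 * kMoment (dz (dz Ψ)) R + α * (5 + α) * R * kMoment (dz Ψ) R) := by
  have _hR := hR
  have hdz : ContDiff ℝ 1 (uncurry (dz Ψ)) := contDiff_dz_of_contDiff (n := 1) hΨ
  -- the slice `u = Ψ(R,·)`
  set u : ℝ → ℝ := fun θ => Ψ R θ with hu
  have huc : ContDiff ℝ 2 u := hΨ.comp (contDiff_const.prodMk contDiff_id)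
  have hu' : deriv u = fun θ => dθ Ψ R θ := by funext θ; rfl
  have hu'' : deriv (deriv u) = fun θ => dθ (dθ Ψ) R θ := by rw [hu']; funext θ; rfl
  have hud : Differentiable ℝ u := huc.differentiable (by simp)
  have huc1 : ContDiff ℝ 1 (deriv u) := by have := huc.iterate_deriv' 1 1; simpa using this
  have hcont_u : Continuous u := huc.continuous
  have hcont_u' : Continuous (deriv u) := huc1.continuous
  have hcont_u'' : Continuous (deriv (deriv u)) := huc1.continuous_deriv le_rfl
  have hdz2c : Continuous (uncurry (dz (dz Ψ))) := continuous_dz hdz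
  have hc1 : Continuous fun θ => dz Ψ R θ := hdz.continuous.comp (Continuous.prodMk_right R)
  have hc2 : Continuous fun θ => dz (dz Ψ) R θ := hdz2c.comp (Continuous.prodMk_right R)
  have hadj := integral_angularOp_mul_adjointMode huc (hD0 R) (hD1 R)
  rw [hu'', hu'] at hadj
  simp only [hu] at hadj
  have hpt : ∀ θ ∈ Ioo 0 (π / 2), ellipticOp α Ψ R θ * kernelK θ =
      -((α ^ 2 * R ^ 2 * dz (dz Ψ) R θ + α * (5 + α) * R * dz Ψ R θ) * kernelK θ) + 3 * (-dθ (dθ Ψ) R θ * (Real.sin θ * Real.cos θ ^ 2) +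
        dθ Ψ R θ * (Real.sin θ ^ 2 * Real.cos θ) + Ψ R θ * (Real.sin θ - 6 * (Real.sin θ * Real.cos θ ^ 2))) := by
    intro θ hθ
    have hcos : Real.cos θ ≠ 0 := (Real.cos_pos_of_mem_Ioo ⟨by linarith [hθ.1, Real.pi_pos], hθ.2⟩).ne'
    rw [ellipticOp_eq_expanded α (hud θ) hcos]
    unfold kernelK
    field_simp
    ring
  have hK : Continuous kernelK := continuous_kernelK
  have iL : IntegrableOn (fun θ => -((α ^ 2 * R ^ 2 * dz (dz Ψ) R θ + α * (5 + α) * R * dz Ψ R θ) * kernelK θ)) (Ioo 0 (π / 2)) :=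
    ((by fun_prop : Continuous fun θ => -((α ^ 2 * R ^ 2 * dz (dz Ψ) R θ + α * (5 + α) * R * dz Ψ R θ) * kernelK θ))
      |>.continuousOn.integrableOn_Icc).mono_set Ioo_subset_Icc_self
  have iA : IntegrableOn (fun θ => 3 * (-dθ (dθ Ψ) R θ * (Real.sin θ * Real.cos θ ^ 2) +
      dθ Ψ R θ * (Real.sin θ ^ 2 * Real.cos θ) + Ψ R θ * (Real.sin θ - 6 * (Real.sin θ * Real.cos θ ^ 2)))) (Ioo 0 (π / 2)) := by
    have h1 : Continuous fun θ => dθ (dθ Ψ) R θ := by rw [← hu'']; exact hcont_u''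
    have h2 : Continuous fun θ => dθ Ψ R θ := by rw [← hu']; exact hcont_u'
    have h3 : Continuous fun θ => Ψ R θ := hcont_u
    exact ((by fun_prop : Continuous fun θ => 3 * (-dθ (dθ Ψ) R θ * (Real.sin θ * Real.cos θ ^ 2) +
      dθ Ψ R θ * (Real.sin θ ^ 2 * Real.cos θ) + Ψ R θ * (Real.sin θ - 6 * (Real.sin θ * Real.cos θ ^ 2))))
      |>.continuousOn.integrableOn_Icc).mono_set Ioo_subset_Icc_self
  have hadj' : ∫ θ in Ioo 0 (π / 2), (-dθ (dθ Ψ) R θ * (Real.sin θ * Real.cos θ ^ 2) +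
      dθ Ψ R θ * (Real.sin θ ^ 2 * Real.cos θ) + Ψ R θ * (Real.sin θ - 6 * (Real.sin θ * Real.cos θ ^ 2))) = 0 := by
    rw [← integral_Ioc_eq_integral_Ioo, ← intervalIntegral.integral_of_le (by positivity : (0 : ℝ) ≤ π / 2)]
    exact hadj
  rw [kMoment_def, setIntegral_congr_fun measurableSet_Ioo hpt, integral_add iL iA, MeasureTheory.integral_neg, MeasureTheory.integral_const_mul,
    hadj', mul_zero, add_zero]
  congr 1
  have i1 : IntegrableOn (fun θ => α ^ 2 * R ^ 2 * (dz (dz Ψ) R θ * kernelK θ)) (Ioo 0 (π / 2)) :=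
    ((hc2.mul hK).continuousOn.integrableOn_Icc.mono_set Ioo_subset_Icc_self).const_mul _
  have i2 : IntegrableOn (fun θ => α * (5 + α) * R * (dz Ψ R θ * kernelK θ)) (Ioo 0 (π / 2)) :=
    ((hc1.mul hK).continuousOn.integrableOn_Icc.mono_set Ioo_subset_Icc_self).const_mul _
  rw [kMoment_def, kMoment_def, ← MeasureTheory.integral_const_mul, ← MeasureTheory.integral_const_mul, ← integral_add i1 i2]
  exact setIntegral_congr_fun measurableSet_Ioo fun θ _ => by ring

/-- **`(L(Ψ), K)_θ ≡ 0` on `R > 0` for profiles in the test class** (compactly supported `C²` with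
`Ψ(R,0) = Ψ(R,π/2) = 0` and `(Ψ, K)_θ ≡ 0` on `R > 0`). [cite: Elgindi2021, §7.1 proof of Proposition 7.1, Step 1 (p. 19 of arXiv:1904.04795)] -/
theorem kMoment_ellipticOp_eq_zero (α : ℝ) {Ψ : ℝ → ℝ → ℝ} (hΨ : ContDiff ℝ 2 (uncurry Ψ)) (hs : HasCompactSupport (uncurry Ψ))
    (hD0 : ∀ R, Ψ R 0 = 0) (hD1 : ∀ R, Ψ R (π / 2) = 0) (hK : ∀ R, 0 < R → kMoment Ψ R = 0) {R : ℝ} (hR : 0 < R) :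
    kMoment (ellipticOp α Ψ) R = 0 := by
  have hΨ1 : ContDiff ℝ 1 (uncurry Ψ) := hΨ.of_le (by norm_num)
  have hdz : ContDiff ℝ 1 (uncurry (dz Ψ)) := contDiff_dz_of_contDiff (n := 1) hΨ
  have hdzs : HasCompactSupport (uncurry (dz Ψ)) := hasCompactSupport_dz hs
  have hy' : ∀ R, deriv (kMoment Ψ) R = kMoment (dz Ψ) R := fun R => deriv_kMoment hΨ1 hs R
  have hy'' : ∀ R, deriv (kMoment (dz Ψ)) R = kMoment (dz (dz Ψ)) R := fun R => deriv_kMoment hdz hdzs R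
  -- `kMoment Ψ ≡ 0` near `R`, hence its derivatives vanish at `R`
  have h0 : kMoment Ψ =ᶠ[𝓝 R] fun _ => 0 := Filter.eventuallyEq_of_mem (Ioi_mem_nhds hR) fun R' hR' => hK R' hR'
  have h1 : kMoment (dz Ψ) R = 0 := by rw [← hy' R, h0.deriv_eq, deriv_const]
  have h1' : kMoment (dz Ψ) =ᶠ[𝓝 R] fun _ => 0 := by
    have : ∀ R' ∈ Ioi (0:ℝ), kMoment (dz Ψ) R' = 0 := fun R' hR' => by
      have h0' : kMoment Ψ =ᶠ[𝓝 R'] fun _ => 0 := Filter.eventuallyEq_of_mem (Ioi_mem_nhds hR') fun R'' hR'' => hK R'' hR''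
      rw [← hy' R', h0'.deriv_eq, deriv_const]
    exact Filter.eventuallyEq_of_mem (Ioi_mem_nhds hR) this
  have h2 : kMoment (dz (dz Ψ)) R = 0 := by rw [← hy'' R, h1'.deriv_eq, deriv_const]
  rw [kMoment_ellipticOp α hΨ hD0 hD1 hR, h1, h2]; ring

/-! ### The `K`-profile test functions -/

/-- A smooth compactly supported cutoff equal to `1` on `[0, π/2]` (a bump centred at `π/4`). [folklore] -/
def thetaCutoff : ℝ → ℝ := (⟨2, 3, by norm_num, by norm_num⟩ : ContDiffBump (π / 4 : ℝ))

/-- The cutoff is smooth. [folklore] -/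
theorem contDiff_thetaCutoff {n : ℕ∞} : ContDiff ℝ n thetaCutoff := ContDiffBump.contDiff _

/-- The cutoff is compactly supported. [folklore] -/
theorem hasCompactSupport_thetaCutoff : HasCompactSupport thetaCutoff := ContDiffBump.hasCompactSupport _

/-- The cutoff is `1` on `[0, π/2]` (indeed on `[π/4 − 2, π/4 + 2]`). [folklore] -/
theorem thetaCutoff_eq_one {θ : ℝ} (hθ : θ ∈ Icc 0 (π / 2)) : thetaCutoff θ = 1 := by
  apply ContDiffBump.one_of_mem_closedBall
  rw [Metric.mem_closedBall, Real.dist_eq]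
  have hπ : π < 4 := Real.pi_lt_four
  rw [abs_le]; constructor <;> linarith [hθ.1, hθ.2, Real.pi_pos]

/-- The angular factor `s(θ) = sin θcos θ·η(θ)` of the `K`-profile test functions (`cos θ·s = K/3` on
the strip). [folklore] -/
def kAngular (θ : ℝ) : ℝ := Real.sin θ * Real.cos θ * thetaCutoff θ

/-- `s` is smooth. [folklore] -/
theorem contDiff_kAngular {n : ℕ∞} : ContDiff ℝ n kAngular := by
  unfold kAngular; exact (Real.contDiff_sin.mul Real.contDiff_cos).mul contDiff_thetaCutoff

/-- `s` is compactly supported. [folklore] -/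
theorem hasCompactSupport_kAngular : HasCompactSupport kAngular := hasCompactSupport_thetaCutoff.mul_left

/-- `s(0) = 0`. [folklore] -/
theorem kAngular_zero : kAngular 0 = 0 := by simp [kAngular]

/-- On the strip `cos θ·s(θ) = K(θ)/3`. [folklore] -/
theorem cos_mul_kAngular {θ : ℝ} (hθ : θ ∈ Icc 0 (π / 2)) : Real.cos θ * kAngular θ = kernelK θ / 3 := by
  unfold kAngular kernelK; rw [thetaCutoff_eq_one hθ]; ring

/-- **The `K`-profile test function** `χ_m(R, θ) = m(R)·s(θ)` for a radial amplitude `m`. [folklore] -/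
def kProfile (m : ℝ → ℝ) : ℝ → ℝ → ℝ := fun R θ => m R * kAngular θ

/-- `χ_m` is `Cⁿ` when `m` is. [folklore] -/
theorem contDiff_kProfile {m : ℝ → ℝ} {n : ℕ∞} (hm : ContDiff ℝ n m) : ContDiff ℝ n (uncurry (kProfile m)) := by
  have e : uncurry (kProfile m) = fun p : ℝ × ℝ => m p.1 * kAngular p.2 := by funext p; rfl
  rw [e]; exact (hm.comp contDiff_fst).mul (contDiff_kAngular.comp contDiff_snd)

/-- `χ_m` is compactly supported when `m` is. [folklore] -/
theorem hasCompactSupport_kProfile {m : ℝ → ℝ} (hm : HasCompactSupport m) : HasCompactSupport (uncurry (kProfile m)) := by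
  have e : uncurry (kProfile m) = fun p : ℝ × ℝ => m p.1 * kAngular p.2 := by funext p; rfl
  rw [e]
  refine HasCompactSupport.of_support_subset_isCompact (hm.isCompact.prod hasCompactSupport_kAngular.isCompact) fun p hp => ?_
  simp only [mem_support, ne_eq, mul_eq_zero, not_or] at hp
  exact ⟨subset_closure hp.1, subset_closure hp.2⟩

/-- The support of `χ_m` lies over the support of `m`. [folklore] -/
theorem tsupport_kProfile_fst {m : ℝ → ℝ} {p : ℝ × ℝ} (hp : p ∈ tsupport (uncurry (kProfile m))) : p.1 ∈ tsupport m := by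
  have h : tsupport (uncurry (kProfile m)) ⊆ (tsupport m) ×ˢ (univ : Set ℝ) := by
    refine closure_minimal (fun q hq => ?_) ((isClosed_tsupport m).prod isClosed_univ)
    simp only [mem_support, ne_eq] at hq
    refine ⟨subset_closure fun h0 => hq ?_, mem_univ _⟩
    show m q.1 * kAngular q.2 = 0
    rw [show m q.1 = 0 from h0, zero_mul]
  exact (h hp).1

/-! ### `B(·, Jχ_m) = 0` on the energy space -/

/-- The `K`-moment of a `K`-profile: `(cos θχ_m(R,·), K)_θ = m(R)·c₀`, `c₀ = ∫₀^{π/2}K²/3`. [folklore] -/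
theorem kMoment_cos_kProfile (m : ℝ → ℝ) (R : ℝ) :
    kMoment (fun R θ => Real.cos θ * kProfile m R θ) R = m R * ∫ θ in Ioo 0 (π / 2), kernelK θ ^ 2 / 3 := by
  rw [kMoment_def, ← MeasureTheory.integral_const_mul]
  refine setIntegral_congr_fun measurableSet_Ioo fun θ hθ => ?_
  show Real.cos θ * (m R * kAngular θ) * kernelK θ = _
  have h := cos_mul_kAngular (Ioo_subset_Icc_self hθ)
  calc Real.cos θ * (m R * kAngular θ) * kernelK θ = m R * (Real.cos θ * kAngular θ) * kernelK θ := by ring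
    _ = _ := by rw [h]; ring

/-- `c₀ = ∫₀^{π/2}K²/3 > 0`. [folklore] -/
theorem kNormSq_pos : 0 < ∫ θ in Ioo 0 (π / 2), kernelK θ ^ 2 / 3 := by
  have hK : Continuous kernelK := continuous_kernelK
  have hb : (0:ℝ) < π / 2 := by positivity
  rw [← integral_Ioc_eq_integral_Ioo, ← intervalIntegral.integral_of_le hb.le]
  refine intervalIntegral.intervalIntegral_pos_of_pos_on ((by fun_prop : Continuous fun θ => kernelK θ ^ 2 / 3).intervalIntegrable _ _) (fun θ hθ => ?_) hb
  have hs : 0 < Real.sin θ := Real.sin_pos_of_pos_of_lt_pi hθ.1 (by linarith [hθ.2])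
  have hc : 0 < Real.cos θ := Real.cos_pos_of_mem_Ioo ⟨by linarith [hθ.1], hθ.2⟩
  have : 0 < kernelK θ := by unfold kernelK; positivity
  positivity

section kProfileTest

variable {α : ℝ} {m : ℝ → ℝ} (hm : ∀ n : ℕ, ContDiff ℝ n m) (hms : HasCompactSupport m) (hmpos : ∀ R ∈ tsupport m, 0 < R)
include hm hms hmpos

/-- The `K`-profile `χ_m` is a test profile: smooth, compactly supported inside `R > 0`, `χ_m(R,0) = 0`. [folklore] -/
theorem kProfile_test : (∀ n : ℕ, ContDiff ℝ n (uncurry (kProfile m))) ∧ HasCompactSupport (uncurry (kProfile m)) ∧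
    (∀ p ∈ tsupport (uncurry (kProfile m)), 0 < p.1) ∧ (∀ R, kProfile m R 0 = 0) :=
  ⟨fun n => contDiff_kProfile (hm n), hasCompactSupport_kProfile hms, fun p hp => hmpos p.1 (tsupport_kProfile_fst hp),
    fun R => by simp [kProfile, kAngular_zero]⟩

/-- **`B(Jχ, Jχ_m) = 0` for `χ` in the orthogonal test class**: by Green's identity it is
`∫∫ L(Ψ)·m(R)K(θ)/3 = ∫ m(R)(L(Ψ),K)_θ/3 dR = 0`. [cite: Elgindi2021, §7.1 proof of Proposition 7.1, Step 1 (p. 19 of arXiv:1904.04795)] -/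
theorem energyForm_graphElt_kProfile_eq_zero {χ : ℝ → ℝ → ℝ} (hχ : χ ∈ orthClass) :
    energyForm α (graphElt α χ) (graphElt α (kProfile m)) = 0 := by
  obtain ⟨hsm, hs, hpos, hχ0, hK⟩ := hχ
  obtain ⟨hKm, hKs, hKpos, hK0⟩ := kProfile_test hm hms hmpos
  have h2 : ContDiff ℝ 2 (uncurry χ) := hsm 2
  obtain ⟨Ψ, hΨ⟩ : ∃ Ψ : ℝ → ℝ → ℝ, Ψ = fun R θ => Real.cos θ * χ R θ := ⟨_, rfl⟩
  rw [← integral_strip_ellipticOp_mul_eq_energyForm α h2 hs hpos (hKm 1) hKs hKpos hK0 hΨ]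
  -- replace `L(Ψ)` by its smooth representative to apply Fubini
  obtain ⟨gF, hgF⟩ : ∃ gF : ℝ → ℝ → ℝ, gF = fun R θ => -α ^ 2 * R ^ 2 * dz (dz Ψ) R θ - α * (5 + α) * R * dz Ψ R θ -
      dθ (dθ Ψ) R θ + (Real.cos θ * χ R θ + Real.sin θ * dθ χ R θ) - 6 * Ψ R θ := ⟨_, rfl⟩
  have hFeq := ellipticOp_eq_smoothRep α hΨ hgF h2
  have hgFc : ContDiff ℝ (0 : ℕ) (uncurry gF) := contDiff_smoothRep α hΨ hgF (n := 0) (by exact_mod_cast h2)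
  have hgFs : HasCompactSupport (uncurry gF) := hasCompactSupport_smoothRep α hΨ hgF hs
  have cG : Continuous fun p : ℝ × ℝ => gF p.1 p.2 := hgFc.continuous
  have cT : Continuous fun p : ℝ × ℝ => graphFn α (kProfile m) 0 p := continuous_graphFn (hKm 1) 0
  have iGT : Integrable fun p : ℝ × ℝ => gF p.1 p.2 * graphFn α (kProfile m) 0 p :=
    (cG.mul cT).integrable_of_hasCompactSupport ((hasCompactSupport_graphFn (α := α) hKs 0).mul_left)
  rw [setIntegral_congr_fun measurableSet_strip (fun p hp => by rw [hFeq p hp] :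
      ∀ p ∈ strip, ellipticOp α Ψ p.1 p.2 * graphFn α (kProfile m) 0 p = gF p.1 p.2 * graphFn α (kProfile m) 0 p),
    integral_strip_eq_integral_Ioi_integral_Ioo iGT]
  refine setIntegral_eq_zero_of_forall_eq_zero fun R hR => ?_
  -- the slice: `∫ gF(R,θ) cosθ m(R) s(θ) dθ = m(R)/3 · (L(Ψ), K)_θ(R) = 0`
  have hD0 : ∀ R, Ψ R 0 = 0 := fun R => by rw [hΨ]; simp [hχ0 R]
  have hD1 : ∀ R, Ψ R (π / 2) = 0 := fun R => by rw [hΨ]; simp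
  have hΨ2 : ContDiff ℝ 2 (uncurry Ψ) := by rw [hΨ]; exact contDiff_cosProfile h2
  have hΨs : HasCompactSupport (uncurry Ψ) := by rw [hΨ]; exact hasCompactSupport_cosProfile hs
  have hKΨ : ∀ R, 0 < R → kMoment Ψ R = 0 := fun R hR => by rw [hΨ]; exact hK R hR
  have h0 := kMoment_ellipticOp_eq_zero α hΨ2 hΨs hD0 hD1 hKΨ hR
  rw [kMoment_def] at h0
  calc ∫ θ in Ioo 0 (π / 2), gF (R, θ).1 (R, θ).2 * graphFn α (kProfile m) 0 (R, θ)
      = ∫ θ in Ioo 0 (π / 2), m R / 3 * (ellipticOp α Ψ R θ * kernelK θ) := by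
        refine setIntegral_congr_fun measurableSet_Ioo fun θ hθ => ?_
        have hp : (R, θ) ∈ strip := ⟨hR, hθ⟩
        show gF R θ * (Real.cos θ * kProfile m R θ) = _
        rw [← hFeq (R, θ) hp]
        show ellipticOp α Ψ R θ * (Real.cos θ * (m R * kAngular θ)) = _
        have hc := cos_mul_kAngular (Ioo_subset_Icc_self hθ)
        calc ellipticOp α Ψ R θ * (Real.cos θ * (m R * kAngular θ)) = m R * (Real.cos θ * kAngular θ) * ellipticOp α Ψ R θ := by ring
          _ = _ := by rw [hc]; ring
    _ = 0 := by rw [MeasureTheory.integral_const_mul, h0, mul_zero]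

omit hm hms hmpos in
/-- `U ↦ B(U, V)` is continuous. [folklore] -/
theorem continuous_energyForm_left (α : ℝ) (V : E4) : Continuous fun U : E4 => energyForm α U V :=
  ((energyForm α).flip V).continuous

/-- **`B(U, Jχ_m) = 0` for every `U` in the energy space** (density). [folklore] -/
theorem energyForm_kProfile_eq_zero {U : E4} (hU : U ∈ weakSpace α) : energyForm α U (graphElt α (kProfile m)) = 0 := by
  have hcl : IsClosed {U : E4 | energyForm α U (graphElt α (kProfile m)) = 0} :=
    isClosed_eq (continuous_energyForm_left α _) continuous_const
  have hsub : (LinearMap.range (graphL α) : Set E4) ⊆ {U : E4 | energyForm α U (graphElt α (kProfile m)) = 0} := by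
    rintro U ⟨χ, rfl⟩
    rw [Set.mem_setOf_eq, graphL_apply]
    exact energyForm_graphElt_kProfile_eq_zero hm hms hmpos χ.2
  have hU' : U ∈ closure ((LinearMap.range (graphL α) : Set E4)) := by
    rw [← Submodule.topologicalClosure_coe]; exact hU
  exact closure_minimal hsub hcl hU'

/-- **Data orthogonal to `K` do not see `χ_m`**: if `∫∫ F·n(R)K(θ) = 0` for all continuous compactly
supported radial `n`, then `⟨F, (Jχ_m)₀⟩ = 0`. [folklore] -/
theorem inner_datum_graphElt_kProfile_eq_zero {F : L2Strip}
    (HF : ∀ n : ℝ → ℝ, Continuous n → HasCompactSupport n → ∫ p in strip, (F : ℝ × ℝ → ℝ) p * (n p.1 * kernelK p.2) = 0) :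
    ⟪F, graphElt α (kProfile m) 0⟫_ℝ = 0 := by
  obtain ⟨hKm, hKs, hKpos, hK0⟩ := kProfile_test hm hms hmpos
  rw [graphElt_apply, inner_L2Strip]
  have hmem := memLp_graphFn (α := α) (hKm 1) hKs 0
  have e1 : ∫ p in strip, (F : ℝ × ℝ → ℝ) p * (toL2 (graphFn α (kProfile m) 0) : ℝ × ℝ → ℝ) p =
      ∫ p in strip, (F : ℝ × ℝ → ℝ) p * graphFn α (kProfile m) 0 p := by
    refine integral_congr_ae ?_
    filter_upwards [toL2_ae_eq' hmem] with p hp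
    rw [hp]
  rw [e1]
  have e2 : ∫ p in strip, (F : ℝ × ℝ → ℝ) p * graphFn α (kProfile m) 0 p =
      ∫ p in strip, (F : ℝ × ℝ → ℝ) p * ((fun R => m R / 3) p.1 * kernelK p.2) := by
    refine setIntegral_congr_fun measurableSet_strip fun p hp => ?_
    show (F : ℝ × ℝ → ℝ) p * (Real.cos p.2 * (m p.1 * kAngular p.2)) = _
    have hc := cos_mul_kAngular (Ioo_subset_Icc_self hp.2)
    calc (F : ℝ × ℝ → ℝ) p * (Real.cos p.2 * (m p.1 * kAngular p.2)) = (F : ℝ × ℝ → ℝ) p * (m p.1 * (Real.cos p.2 * kAngular p.2)) := by ring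
      _ = _ := by rw [hc]; simp only []; ring
  rw [e2]
  exact HF (fun R => m R / 3) ((hm 0).continuous.div_const _) (hms.mono fun R hR => by
    intro h0; apply hR; show m R / 3 = 0; rw [h0, zero_div])

end kProfileTest

/-! ### Decomposition of a test profile and the weak equation against all test profiles -/

/-- The `K`-moment of a compactly supported plane function is compactly supported. [folklore] -/
theorem hasCompactSupport_kMoment {g : ℝ → ℝ → ℝ} (hs : HasCompactSupport (uncurry g)) : HasCompactSupport (kMoment g) := by
  refine HasCompactSupport.of_support_subset_isCompact (hs.isCompact.image continuous_fst) fun R hR => ?_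
  by_contra h
  apply hR
  refine kMoment_eq_zero_of_forall fun θ => ?_
  have hn : (R, θ) ∉ tsupport (uncurry g) := fun hm => h ⟨(R, θ), hm, rfl⟩
  have := image_eq_zero_of_notMem_tsupport hn
  exact this

set_option maxHeartbeats 1600000 in
/-- **The weak solution tests against every test profile** when the datum is orthogonal to `K`:
if `U` in the energy space satisfies `B(U,Φ) = ⟨F,Φ₀⟩` for all `Φ` in the energy space and
`∫∫ F·n(R)K(θ) = 0` for all radial `n ∈ C_c`, then `B(U, Jχ₂) = ⟨F, (Jχ₂)₀⟩` for every smooth `χ₂`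
compactly supported inside `R > 0` with `χ₂(R,0) = 0` (no orthogonality required of `χ₂`).
[cite: Elgindi2021, §7.1 Proposition 7.1 and its proof, Step 1 (p. 19 of arXiv:1904.04795)] -/
theorem weakSolution_test {α : ℝ} {F : L2Strip}
    (HF : ∀ n : ℝ → ℝ, Continuous n → HasCompactSupport n → ∫ p in strip, (F : ℝ × ℝ → ℝ) p * (n p.1 * kernelK p.2) = 0)
    {U : E4} (hU : U ∈ weakSpace α) (hw : ∀ Φ ∈ weakSpace α, energyForm α U Φ = ⟪F, Φ 0⟫_ℝ)
    {χ₂ : ℝ → ℝ → ℝ} (hχ₂ : ∀ n : ℕ, ContDiff ℝ n (uncurry χ₂)) (hs₂ : HasCompactSupport (uncurry χ₂))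
    (hpos₂ : ∀ p ∈ tsupport (uncurry χ₂), 0 < p.1) (h0₂ : ∀ R, χ₂ R 0 = 0) :
    energyForm α U (graphElt α χ₂) = ⟪F, graphElt α χ₂ 0⟫_ℝ := by
  -- the amplitude `m = (cosθχ₂, K)_θ / c₀`
  set c₀ : ℝ := ∫ θ in Ioo 0 (π / 2), kernelK θ ^ 2 / 3 with hc₀
  have hc₀pos : 0 < c₀ := kNormSq_pos
  obtain ⟨Φ₂, hΦ₂⟩ : ∃ Φ₂ : ℝ → ℝ → ℝ, Φ₂ = fun R θ => Real.cos θ * χ₂ R θ := ⟨_, rfl⟩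
  have hΦ₂n : ∀ n : ℕ, ContDiff ℝ n (uncurry Φ₂) := fun n => by rw [hΦ₂]; exact contDiff_cosProfile (hχ₂ n)
  have hΦ₂s : HasCompactSupport (uncurry Φ₂) := by rw [hΦ₂]; exact hasCompactSupport_cosProfile hs₂
  set m : ℝ → ℝ := fun R => kMoment Φ₂ R / c₀ with hmdef
  have hm : ∀ n : ℕ, ContDiff ℝ n m := fun n => (contDiff_kMoment (hΦ₂n n) hΦ₂s).div_const _
  have hms : HasCompactSupport m := (hasCompactSupport_kMoment hΦ₂s).mono fun R hR => by
    intro h0; apply hR; show kMoment Φ₂ R / c₀ = 0; rw [h0, zero_div]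
  have hΦ₂sub : tsupport (uncurry Φ₂) ⊆ tsupport (uncurry χ₂) :=
    tsupport_subset_of_eq_zero (X := uncurry χ₂) (g := uncurry Φ₂) fun q hq => by
      show Φ₂ q.1 q.2 = 0
      rw [hΦ₂]; simp [show χ₂ q.1 q.2 = 0 from hq]
  have hmpos : ∀ R ∈ tsupport m, 0 < R := by
    intro R hR
    have hsub : tsupport m ⊆ Prod.fst '' tsupport (uncurry Φ₂) := by
      refine closure_minimal (fun R' hR' => ?_) ((hΦ₂s.isCompact.image continuous_fst).isClosed)
      by_contra h
      apply hR'
      show kMoment Φ₂ R' / c₀ = 0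
      rw [kMoment_eq_zero_of_forall fun θ => ?_, zero_div]
      have hn : (R', θ) ∉ tsupport (uncurry Φ₂) := fun hm' => h ⟨(R', θ), hm', rfl⟩
      have := image_eq_zero_of_notMem_tsupport hn
      exact this
    obtain ⟨p, hp, rfl⟩ := hsub hR
    exact hpos₂ p (hΦ₂sub hp)
  -- the orthogonal part `χ⊥ = χ₂ − χ_m` belongs to the orthogonal test class
  obtain ⟨hKm, hKs, hKpos, hK0⟩ := kProfile_test hm hms hmpos
  set χo : ℝ → ℝ → ℝ := fun R θ => χ₂ R θ - kProfile m R θ with hχo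
  have hχo_mem : χo ∈ orthClass := by
    have eu : uncurry χo = fun p => uncurry χ₂ p - uncurry (kProfile m) p := by funext p; rfl
    refine ⟨fun n => ?_, ?_, fun p hp => ?_, fun R => ?_, fun R hR => ?_⟩
    · rw [eu]; exact (hχ₂ n).sub (hKm n)
    · rw [eu]; exact hs₂.sub hKs
    · rw [eu] at hp
      have e2 : (fun p => uncurry χ₂ p - uncurry (kProfile m) p) = (uncurry χ₂) + fun p => -uncurry (kProfile m) p := by
        funext p; simp [sub_eq_add_neg]
      rw [e2] at hp
      have h := (tsupport_add (uncurry χ₂) (fun p => -uncurry (kProfile m) p)) hp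
      rcases h with h | h
      · exact hpos₂ p h
      · have e3 : (fun p => -uncurry (kProfile m) p) = -uncurry (kProfile m) := rfl
        rw [e3, tsupport_neg] at h; exact hKpos p h
    · show χ₂ R 0 - kProfile m R 0 = 0
      rw [h0₂ R, hK0 R, sub_zero]
    · have c1 : Continuous (uncurry fun R θ => Real.cos θ * χ₂ R θ) := (contDiff_cosProfile (hχ₂ 0)).continuous
      have c2 : Continuous (uncurry fun R θ => -(Real.cos θ * kProfile m R θ)) :=
        (contDiff_cosProfile (hKm 0)).continuous.neg
      have e : (fun R θ => Real.cos θ * χo R θ) = fun R θ => Real.cos θ * χ₂ R θ + -(Real.cos θ * kProfile m R θ) := by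
        funext R θ; simp only [hχo]; ring
      have e2 : (fun R θ => -(Real.cos θ * kProfile m R θ)) = fun R θ => (-1) * (Real.cos θ * kProfile m R θ) := by
        funext R θ; ring
      rw [e, kMoment_add c1 c2, e2, kMoment_const_mul, kMoment_cos_kProfile, ← hc₀]
      have : kMoment (fun R θ => Real.cos θ * χ₂ R θ) R = kMoment Φ₂ R := by rw [hΦ₂]
      rw [this]
      simp only [hmdef]
      field_simp
      ring
  -- `Jχ₂ = Jχ⊥ + Jχ_m`
  have hsum : graphElt α χ₂ = graphElt α χo + graphElt α (kProfile m) := by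
    have e : χ₂ = χo + kProfile m := by funext R θ; simp [hχo]
    have h1 : ContDiff ℝ 1 (uncurry χo) := hχo_mem.1 1
    have h2 : ContDiff ℝ 1 (uncurry (kProfile m)) := hKm 1
    ext k : 1
    show toL2 (graphFn α χ₂ k) = toL2 (graphFn α χo k) + toL2 (graphFn α (kProfile m) k)
    rw [e, graphFn_add h1 h2, toL2_add (memLp_graphFn h1 hχo_mem.2.1 k) (memLp_graphFn h2 hKs k)]
  have hB0 : energyForm α U (graphElt α (kProfile m)) = 0 := energyForm_kProfile_eq_zero hm hms hmpos hU
  have hF0 : ⟪F, graphElt α (kProfile m) 0⟫_ℝ = 0 := inner_datum_graphElt_kProfile_eq_zero hm hms hmpos HF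
  have hwo := hw _ (graphElt_mem_weakSpace α hχo_mem)
  rw [hsum, map_add, hwo, hB0, add_zero]
  show ⟪F, graphElt α χo 0⟫_ℝ = ⟪F, graphElt α χo 0 + graphElt α (kProfile m) 0⟫_ℝ
  rw [inner_add_right, hF0, add_zero]

end Elgindi

end Literature.Analysis.FluidPDE
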